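import Literature.MathematicalPhysics.KineticTheory.SerrePeriodicPayloadNodeWeights
import HarnessLib

/-!
# Serre's periodic payload bound (`SerrePeriodicPayloadBound`): fact decomposition — the weighted
# node inequality of compensated integrability as the one named input

Topic `MathematicalPhysics/KineticTheory`. FACT-SPLIT file (librarian, mode `fact-decompose`,
2026-08-16) for the budget-capped XL named fact
`Literature.MathematicalPhysics.KineticTheory.SerrePeriodicPayloadBound` (`SerrePeriodicPayload.lean`;
D. Serre, *Compensated integrability on tori; a priori estimate for space-periodic gas flows*,
C. R. Math. 362 (2024), Thm. 6 with (7), proved in §5 as (19)–(20)).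

State of the tree (2026-08-16): the two elementary steps of Serre's §5 are PROVED —
`serrePeriodicPayloadBound_of_inhomogeneous` (`SerrePeriodicPayloadProofs.lean`: the
scaling-and-absorption step (18) ⇒ (19)–(20)) and `inhomogeneous_of_nodeWeights`
(`SerrePeriodicPayloadNodeWeights.lean`: the optimisation over the node weights, display before (18)
⇒ (18)); and the billiard mass–momentum tensor with its divergence (16) and trace (17) is constructed
as a Div-controlled matrix measure (`Literature/Analysis/FluidPDE/BilliardTensor*.lean`,
`SpaceTimeDivMeasure.lean`). What is not in the tree is the core of the paper, Compensated
Integrability with determinantal masses (Serre 2024, Thm. 11, (14)), and its OUTPUT for the corrected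
billiard tensor — the weighted node inequality displayed before (18) on p. 1439 — is exactly the
hypothesis `h14` of `serrePeriodicPayloadBound_of_nodeWeights`. This file names that output
(D-0014 named fact) and records the PROVED assembly:

* `Serre2024_weightedNodeInequality` — for `d = 3`: there is `C` such that for every hard-sphere
  trajectory `γ` of `K` spheres of diameter `ε` on `𝕋³`, every window `[a, b]` and every family of
  nonnegative node weights `w(t, i)`,
  `Σ_{t ∈ coll ∩ [a,b]} Σ_i w(t,i)^{2/3} ‖v_i(t) − v_i(t⁻)‖^{1/3}
     ≤ C (K + √(K E) + (b − a) E + ε · pay + Σ_t Σ_i w(t,i))^{4/3}`,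
  `E = configEnergy (γ a)`, `pay = collisionPayload … γ a b` — Serre's (14) for the billiard tensor
  augmented by the node correctors `b_X S_X`, with the determinantal masses (15), the divergence (16)
  and the trace (17) plugged in [Serre 2024, §5 p. 1439, display before (18); Thm. 11 with (14)–(17)];
* `SerrePeriodicPayloadBound_holds_of : Serre2024_weightedNodeInequality → SerrePeriodicPayloadBound`
  — PROVED (it is `serrePeriodicPayloadBound_of_nodeWeights`).

The child is an intermediate inequality of the printed proof with free weights `w` (the parent has
none), two reduction steps upstream of the parent; it is not a rewording of it. A finer split
(Thm. 11 itself over `MatrixMeasure.HasSpaceTimeDiv`, plus the bookkeeping (15)–(17)) needs the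
measure `(det A)^{1/n}` of a matrix measure and the determinantal point masses, notions not yet in
the tree (framework gap recorded by the librarian).

## References

* D. Serre, *Compensated integrability on tori; a priori estimate for space-periodic gas flows*,
  C. R. Math. Acad. Sci. Paris 362 (2024) 1425–1444, doi:10.5802/crmath.654: §1.4 Thm. 6 and (7);
  §4 Thm. 11; §5 pp. 1438–1440, (14)–(20). [Serre2024]
-/

noncomputable section

open Set Function

namespace Literature.MathematicalPhysics.KineticTheory

open Literature.Analysis.FluidPDE

/-- NAMED FACT — **Serre 2024, §5: the weighted node inequality for hard spheres on `𝕋³`** (the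
display before (18), p. 1439: compensated integrability with determinantal masses, Thm. 11 / (14),
applied to the billiard mass–momentum tensor augmented by the correctors `b_X S_X` at the nodes `X`
of the particle graph, with (15)–(17) plugged in; `d = 3`). There is a constant `C` such that for all
`K`, all `ε > 0`, every hard-sphere trajectory `γ` of `K` spheres of diameter `ε` on the unit flat
torus `𝕋³` (`IsHardSphereTrajectory (Torus.geometry (Fin 3)) ε K γ`), all `a ≤ b` and every
nonnegative weight family `w : ℝ → Fin K → ℝ` (node `X = (t, i)`, `b_X = w t i`,
`|[v]_X| = ‖(γ t i).2 − (leftLim γ t i).2‖`):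
`Σ_{t ∈ collisionTimes ∩ [a,b]} Σ_i w(t,i)^{2/3} |[v]_{(t,i)}|^{1/3}
  ≤ C · (K + √(K·E) + (b − a)·E + ε · collisionPayload … γ a b + Σ_{t} Σ_i w(t,i))^{4/3}`
with `E = configEnergy (γ a)`. This is the hypothesis `h14` of `serrePeriodicPayloadBound_of_nodeWeights`
(`SerrePeriodicPayloadNodeWeights.lean`), verbatim. Users take `(h : Serre2024_weightedNodeInequality)`.
[cite: Serre2024, §5 p. 1439 (display before (18)), Thm. 11 with (14)–(17)] -/
def Serre2024_weightedNodeInequality : Prop :=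
  ∃ C : ℝ, ∀ (K : ℕ) (ε : ℝ), 0 < ε →
    ∀ γ : ℝ → Config K (Fin 3) T3, IsHardSphereTrajectory (Torus.geometry (Fin 3)) ε K γ →
      ∀ a b : ℝ, a ≤ b → ∀ w : ℝ → Fin K → ℝ, (∀ t i, 0 ≤ w t i) →
        (∑ᶠ t ∈ collisionTimes (Torus.geometry (Fin 3)) ε γ ∩ Icc a b,
            ∑ i, w t i ^ ((2 : ℝ) / 3) * ‖(γ t i).2 - (leftLim γ t i).2‖ ^ ((1 : ℝ) / 3)) ≤
          C * ((K : ℝ) + Real.sqrt ((K : ℝ) * configEnergy (γ a)) +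
            (b - a) * configEnergy (γ a) +
            ε * collisionPayload (Torus.geometry (Fin 3)) ε γ a b +
            ∑ᶠ t ∈ collisionTimes (Torus.geometry (Fin 3)) ε γ ∩ Icc a b, ∑ i, w t i) ^
              ((4 : ℝ) / 3)

/-- **Assembly (PROVED): Serre's periodic payload bound from the weighted node inequality** — the
optimisation over the node weights (`inhomogeneous_of_nodeWeights`, display before (18) ⇒ (18))
followed by the scaling-and-absorption step (`serrePeriodicPayloadBound_of_inhomogeneous`,
(18) ⇒ (19)–(20)); this is `serrePeriodicPayloadBound_of_nodeWeights`. Discharging the child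
discharges `SerrePeriodicPayloadBound`. [cite: Serre2024, §5 pp. 1438–1440, (14)–(20)] -/
theorem SerrePeriodicPayloadBound_holds_of (h : Serre2024_weightedNodeInequality) :
    SerrePeriodicPayloadBound :=
  serrePeriodicPayloadBound_of_nodeWeights h

end Literature.MathematicalPhysics.KineticTheory

end
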